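import Summits.Ventures.PercRepro.RankDistEarsFamily

/-!
# PercRepro — THE ROW (SC) FAILS ON `C₄ + (1, k, k, k)` FOR EVERY `k ≥ 6`, IN THE KERNEL (p9, gen 24)

THE THEOREM (`not_shadowCumulative_kFam_all`): for every `k ≥ 6`, `¬ ShadowCumulative (ears (kFam k)) (3k + 4) (3k + 2)`
— an INFINITE FAMILY of simple, 2-connected, graphic cells (one for each `n = 6k + 6 ≥ 42`) on which the candidate row
C-048 fails. Proof: the two shadow levels of `C₄ + (1, k, k, k)` are the level sums of `RankDistEarsCount`; at the
levels `q = 3k + 2` and `q + 1` the level condition is `k`-free (`levelCond_q_eq`, `levelCond_succ_eq`), so the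
`16 × 256`-term sums expand symbolically (`sum_finset_fin4`, `sum_fun_fin4`; the conditions evaluated by `decide`
inside `simp`) to the CLOSED FORMS, with `a = k·3^{k−1}`, `b = 3^k`, `c = 2^k` (`k = m + 1`):
  `s_q = 3c³ + 9bc² + 9ac² + 12abc + 9ab² + 27a²b` (`levelSum_q0_closed`),
  `s_{q+1} + 9c³ + 9ac² + 12abc = 7b³ + 63ab² + 6bc² + 18b²c` (`levelSum_q1_closed`, additively);
then `(3k + 3)·s_{q+1} < (3k + 4)·s_q` for `k ≥ 7` from `c ≤ b` and the cubic `(3m+6)(567m+1152) < 81(3m+7)(m+1)(m+2)`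
(`family_ineq`), and `k = 6` is `RankDistEarsFamily`'s kernel case. (SC) at the level `q + 1` reads
`(3k+4)·s_q ≤ (3k+3)·s_{q+1}` (`sc_level_succ_arith`). Nothing here moves any window of the crux.
-/

namespace PercRepro.RankDist

open Finset

/-- the k-free level condition at the level q + 1 = K + 2 (K = Σ k): rank = K − #M + min(#(X∪F),3) = K + 2 ⟺ min = #M + 2 -/
def levelCondQ1 (X : Finset (Fin 4)) (T : Fin 4 → Bool × Bool) : Bool :=
  upCond X T && decide (min (X ∪ typeF T).card 3 = (typeM T).card + 2)

/-- At most four hosts. -/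
lemma typeM_card_le (T : Fin 4 → Bool × Bool) : (typeM T).card ≤ 4 := by
  have := Finset.card_le_univ (typeM T); simpa using this

/-- At the level `K + 2` the level condition is `K`-free. -/
lemma levelCond_succ_eq (K : ℕ) (hK : 4 ≤ K) (X : Finset (Fin 4)) (T : Fin 4 → Bool × Bool) :
    levelCond K (K + 2) X T = levelCondQ1 X T := by
  unfold levelCond levelCondQ1
  have := typeM_card_le T
  congr 1
  apply decide_eq_decide.2
  omega

/-- The level sum at `q + 1 = 3k + 3` with the `k`-free condition. -/
theorem levelSum_eq_q1 (k : ℕ) (hk : 1 ≤ k) :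
    levelSum (kFam k) (3 * k + 3) = ∑ X : Finset (Fin 4), ∑ T : Fin 4 → Bool × Bool,
      (if levelCondQ1 X T then ∏ j, hostCount (kFam k j) (T j) else 0) := by
  unfold levelSum
  rw [sum_kFam]
  refine Finset.sum_congr rfl (fun X _ => Finset.sum_congr rfl (fun T _ => ?_))
  rw [show 3 * k + 3 = 3 * k + 1 + 2 by ring, levelCond_succ_eq (3 * k + 1) (by omega)]

/-- A sum over `Fin (n+1) → β` is an iterated sum over the head and the tail. -/
lemma sum_fun_fin_succ {β M : Type} [Fintype β] [AddCommMonoid M] {n : ℕ} (g : (Fin (n + 1) → β) → M) :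
    ∑ T, g T = ∑ t : β, ∑ T' : Fin n → β, g (Fin.cons t T') := by
  rw [← (Fin.consEquiv (fun _ => β)).sum_comp, Fintype.sum_prod_type]
  rfl

/-- A sum over `Fin 0 → β` is the value at the empty tuple. -/
lemma sum_fun_fin_zero {β M : Type} [Fintype β] [AddCommMonoid M] (g : (Fin 0 → β) → M) :
    ∑ T, g T = g Fin.elim0 := by
  rw [Fintype.sum_unique]
  rfl

/-- A sum over `Fin 4 → β` of a function of the four values, as a fourfold sum. -/
lemma sum_fun_fin4 {β M : Type} [Fintype β] [AddCommMonoid M] (h : β → β → β → β → M) :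
    ∑ T : Fin 4 → β, h (T 0) (T 1) (T 2) (T 3) = ∑ t0, ∑ t1, ∑ t2, ∑ t3, h t0 t1 t2 t3 := by
  rw [sum_fun_fin_succ]
  refine Finset.sum_congr rfl (fun t0 _ => ?_)
  rw [sum_fun_fin_succ]
  refine Finset.sum_congr rfl (fun t1 _ => ?_)
  rw [sum_fun_fin_succ]
  refine Finset.sum_congr rfl (fun t2 _ => ?_)
  rw [sum_fun_fin_succ]
  refine Finset.sum_congr rfl (fun t3 _ => ?_)
  rw [sum_fun_fin_zero]
  rfl

/-- A tuple is the vector of its values. -/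
lemma fin4_eta {β : Type} (T : Fin 4 → β) : T = ![T 0, T 1, T 2, T 3] := by
  funext i; fin_cases i <;> rfl

/-- The summand of the level sum at `X`, as a function of the four host types. -/
def H4 (k : ℕ) (X : Finset (Fin 4)) (t0 t1 t2 t3 : Bool × Bool) : ℕ :=
  if levelCondQ1 X ![t0, t1, t2, t3] then hostCount 1 t0 * hostCount k t1 * hostCount k t2 * hostCount k t3 else 0

/-- The summand at `X` depends on the four host types only. -/
lemma summand_eq (k : ℕ) (X : Finset (Fin 4)) (T : Fin 4 → Bool × Bool) :
    (if levelCondQ1 X T then ∏ j, hostCount (kFam k j) (T j) else 0) = H4 k X (T 0) (T 1) (T 2) (T 3) := by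
  unfold H4
  rw [Fin.prod_univ_four]
  simp only [kFam, Matrix.cons_val_zero, Matrix.cons_val_one, Matrix.head_cons, Matrix.cons_val_two,
    Matrix.tail_cons]
  have e : ![T 0, T 1, T 2, T 3] = T := (fin4_eta T).symm
  rw [e]
  congr 2

/-- The sixteen subsets of `Fin 4`. -/
lemma sum_finset_fin4 {M : Type} [AddCommMonoid M] (f : Finset (Fin 4) → M) :
    ∑ X : Finset (Fin 4), f X = f ∅ + f {3} + f {2} + f {2, 3} + f {1} + f {1, 3} + f {1, 2} + f {1, 2, 3}
      + f {0} + f {0, 3} + f {0, 2} + f {0, 2, 3} + f {0, 1} + f {0, 1, 3} + f {0, 1, 2} + f {0, 1, 2, 3} := by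
  have h : (Finset.univ : Finset (Finset (Fin 4)))
      = (insert 0 (insert 1 (insert 2 (insert 3 (∅ : Finset (Fin 4)))))).powerset := by
    rw [← Finset.powerset_univ]; rfl
  rw [h]
  have e0 : (0 : Fin 4) ∉ insert 1 (insert 2 (insert 3 (∅ : Finset (Fin 4)))) := by decide
  have e1 : (1 : Fin 4) ∉ insert 2 (insert 3 (∅ : Finset (Fin 4))) := by decide
  have e2 : (2 : Fin 4) ∉ insert 3 (∅ : Finset (Fin 4)) := by decide
  have e3 : (3 : Fin 4) ∉ (∅ : Finset (Fin 4)) := by decide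
  simp only [Finset.sum_powerset_insert e0, Finset.sum_powerset_insert e1, Finset.sum_powerset_insert e2,
    Finset.sum_powerset_insert e3, Finset.powerset_empty, Finset.sum_singleton]
  simp only [Finset.insert_empty]
  abel

set_option maxHeartbeats 4000000 in
/-- THE LEVEL `q + 1` OF `C₄ + (1, k, k, k)`, `k = m + 1`, additively: `s_{q+1} + 9c³ + 9ac² + 12abc = 7b³ + 63ab² + 6bc² + 18b²c`
with `a = (m+1)·3^m`, `b = 3^(m+1)`, `c = 2^(m+1)`. -/
theorem levelSum_q1_closed (m : ℕ) :
    levelSum (kFam (m + 1)) (3 * (m + 1) + 3)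
      + 9 * (2 ^ (m + 1)) ^ 3 + 9 * ((m + 1) * 3 ^ m) * (2 ^ (m + 1)) ^ 2
      + 12 * ((m + 1) * 3 ^ m) * 3 ^ (m + 1) * 2 ^ (m + 1)
    = 7 * (3 ^ (m + 1)) ^ 3 + 63 * ((m + 1) * 3 ^ m) * (3 ^ (m + 1)) ^ 2 + 6 * 3 ^ (m + 1) * (2 ^ (m + 1)) ^ 2
      + 18 * (3 ^ (m + 1)) ^ 2 * 2 ^ (m + 1) := by
  rw [levelSum_eq_q1 (m + 1) (by omega), sum_finset_fin4]
  simp only [summand_eq, sum_fun_fin4, Fintype.sum_prod_type, Fintype.sum_bool]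
  simp (config := {decide := true}) only [H4, hostCount, if_true, if_false, Nat.add_sub_cancel]
  -- remove the truncated subtractions: 3^m = 2^m + d
  obtain ⟨d, hd⟩ : ∃ d, 3 ^ m = 2 ^ m + d := ⟨3 ^ m - 2 ^ m, by
    have : 2 ^ m ≤ 3 ^ m := Nat.pow_le_pow_left (by norm_num) m
    omega⟩
  have h1 : 3 ^ m - 2 ^ m = d := by omega
  have h2 : 3 ^ m * 3 - 2 ^ m * 2 = 2 ^ m + 3 * d := by omega
  simp only [pow_succ]
  simp only [h1, h2]
  simp only [hd]
  ring

/-- the k-free level condition at the level q = K + 1: rank = K − #M + min(#(X∪F),3) = K + 1 ⟺ min = #M + 1 -/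
def levelCondQ0 (X : Finset (Fin 4)) (T : Fin 4 → Bool × Bool) : Bool :=
  upCond X T && decide (min (X ∪ typeF T).card 3 = (typeM T).card + 1)

/-- At the level `K + 1` the level condition is `K`-free. -/
lemma levelCond_q_eq (K : ℕ) (hK : 4 ≤ K) (X : Finset (Fin 4)) (T : Fin 4 → Bool × Bool) :
    levelCond K (K + 1) X T = levelCondQ0 X T := by
  unfold levelCond levelCondQ0
  have := typeM_card_le T
  congr 1
  apply decide_eq_decide.2
  omega

/-- The level sum at `q = 3k + 2` with the `k`-free condition. -/
theorem levelSum_eq_q0 (k : ℕ) (hk : 1 ≤ k) :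
    levelSum (kFam k) (3 * k + 2) = ∑ X : Finset (Fin 4), ∑ T : Fin 4 → Bool × Bool,
      (if levelCondQ0 X T then ∏ j, hostCount (kFam k j) (T j) else 0) := by
  unfold levelSum
  rw [sum_kFam]
  refine Finset.sum_congr rfl (fun X _ => Finset.sum_congr rfl (fun T _ => ?_))
  rw [show 3 * k + 2 = 3 * k + 1 + 1 by ring, levelCond_q_eq (3 * k + 1) (by omega)]

/-- The summand of the level-`q` sum at `X`, as a function of the four host types. -/
def H4q (k : ℕ) (X : Finset (Fin 4)) (t0 t1 t2 t3 : Bool × Bool) : ℕ :=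
  if levelCondQ0 X ![t0, t1, t2, t3] then hostCount 1 t0 * hostCount k t1 * hostCount k t2 * hostCount k t3 else 0

/-- The level-`q` summand at `X` depends on the four host types only. -/
lemma summand_eq_q (k : ℕ) (X : Finset (Fin 4)) (T : Fin 4 → Bool × Bool) :
    (if levelCondQ0 X T then ∏ j, hostCount (kFam k j) (T j) else 0) = H4q k X (T 0) (T 1) (T 2) (T 3) := by
  unfold H4q
  rw [Fin.prod_univ_four]
  simp only [kFam, Matrix.cons_val_zero, Matrix.cons_val_one, Matrix.head_cons, Matrix.cons_val_two,
    Matrix.tail_cons]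
  have e : ![T 0, T 1, T 2, T 3] = T := (fin4_eta T).symm
  rw [e]
  congr 2

set_option maxHeartbeats 4000000 in
/-- THE LEVEL `q` OF `C₄ + (1, k, k, k)`, `k = m + 1`: `s_q = 3c³ + 9bc² + 9ac² + 12abc + 9ab² + 27a²b`. -/
theorem levelSum_q0_closed (m : ℕ) :
    levelSum (kFam (m + 1)) (3 * (m + 1) + 2)
    = 3 * (2 ^ (m + 1)) ^ 3 + 9 * 3 ^ (m + 1) * (2 ^ (m + 1)) ^ 2 + 9 * ((m + 1) * 3 ^ m) * (2 ^ (m + 1)) ^ 2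
      + 12 * ((m + 1) * 3 ^ m) * 3 ^ (m + 1) * 2 ^ (m + 1) + 9 * ((m + 1) * 3 ^ m) * (3 ^ (m + 1)) ^ 2
      + 27 * ((m + 1) * 3 ^ m) ^ 2 * 3 ^ (m + 1) := by
  rw [levelSum_eq_q0 (m + 1) (by omega), sum_finset_fin4]
  simp only [summand_eq_q, sum_fun_fin4, Fintype.sum_prod_type, Fintype.sum_bool]
  simp (config := {decide := true}) only [H4q, hostCount, if_true, if_false, Nat.add_sub_cancel]
  obtain ⟨d, hd⟩ : ∃ d, 3 ^ m = 2 ^ m + d := ⟨3 ^ m - 2 ^ m, by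
    have : 2 ^ m ≤ 3 ^ m := Nat.pow_le_pow_left (by norm_num) m
    omega⟩
  have h1 : 3 ^ m - 2 ^ m = d := by omega
  have h2 : 3 ^ m * 3 - 2 ^ m * 2 = 2 ^ m + 3 * d := by omega
  simp only [pow_succ]
  simp only [h1, h2]
  simp only [hd]
  ring

/-- The polynomial inequality behind the family: `(3m+6)(567m+1152) < 81(3m+7)(m+1)(m+2)` for `m ≥ 6`. -/
lemma family_poly_ineq (m : ℕ) (hm : 6 ≤ m) :
    (3 * m + 6) * (567 * m + 1152) < 81 * (3 * m + 7) * ((m + 1) * (m + 2)) := by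
  obtain ⟨t, rfl⟩ : ∃ t, m = t + 6 := ⟨m - 6, by omega⟩
  nlinarith [sq_nonneg t, Nat.zero_le t, Nat.zero_le (t * t * t)]

/-- **THE ROW (SC) FAILS ON `C₄ + (1, k, k, k)` FOR EVERY `k ≥ 7`, BY THE CLOSED FORMS**:
`(3k + 3)·s_{q+1} < (3k + 4)·s_q`. -/
theorem family_ineq (m : ℕ) (hm : 6 ≤ m) :
    (3 * (m + 1) + 3) * levelSum (kFam (m + 1)) (3 * (m + 1) + 3)
      < (3 * (m + 1) + 4) * levelSum (kFam (m + 1)) (3 * (m + 1) + 2) := by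
  have h1 := levelSum_q1_closed m
  have h0 := levelSum_q0_closed m
  set S1 := levelSum (kFam (m + 1)) (3 * (m + 1) + 3) with hS1
  set S0 := levelSum (kFam (m + 1)) (3 * (m + 1) + 2) with hS0
  set x := 3 ^ m with hx
  set y := 2 ^ m with hy
  have hb : 3 ^ (m + 1) = 3 * x := by rw [pow_succ, hx]; ring
  have hc : 2 ^ (m + 1) = 2 * y := by rw [pow_succ, hy]; ring
  rw [hb, hc] at h1 h0
  have hyx : y ≤ x := Nat.pow_le_pow_left (by norm_num) m
  have hx1 : 1 ≤ x := Nat.one_le_pow _ _ (by norm_num)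
  -- S1 ≤ P ≤ (567 m + 1152) x³ ; S0 ≥ 81 (m+1)(m+2) x³
  have hxy2 : x * y ^ 2 ≤ x ^ 3 := by
    have : y ^ 2 ≤ x ^ 2 := Nat.pow_le_pow_left hyx 2
    calc x * y ^ 2 ≤ x * x ^ 2 := Nat.mul_le_mul_left _ this
      _ = x ^ 3 := by ring
  have hx2y : x ^ 2 * y ≤ x ^ 3 := by
    calc x ^ 2 * y ≤ x ^ 2 * x := Nat.mul_le_mul_left _ hyx
      _ = x ^ 3 := by ring
  have hn1 : 0 ≤ 72 * y ^ 3 + 36 * ((m + 1) * (x * y ^ 2)) + 72 * ((m + 1) * (x ^ 2 * y)) := Nat.zero_le _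
  have hS1le : S1 ≤ (567 * m + 1152) * x ^ 3 := by
    nlinarith [h1, hxy2, hx2y, hn1]
  have hn0 : 0 ≤ 24 * y ^ 3 + 108 * (x * y ^ 2) + 36 * ((m + 1) * (x * y ^ 2)) + 72 * ((m + 1) * (x ^ 2 * y)) :=
    Nat.zero_le _
  have hS0ge : 81 * ((m + 1) * (m + 2)) * x ^ 3 ≤ S0 := by
    nlinarith [h0, hn0]
  have hpoly := family_poly_ineq m hm
  have hx3 : 1 ≤ x ^ 3 := Nat.one_le_pow _ _ hx1
  calc (3 * (m + 1) + 3) * S1 ≤ (3 * m + 6) * ((567 * m + 1152) * x ^ 3) := by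
        rw [show 3 * (m + 1) + 3 = 3 * m + 6 by ring]; exact Nat.mul_le_mul_left _ hS1le
    _ = ((3 * m + 6) * (567 * m + 1152)) * x ^ 3 := by ring
    _ < (81 * (3 * m + 7) * ((m + 1) * (m + 2))) * x ^ 3 := Nat.mul_lt_mul_of_pos_right hpoly hx3
    _ = (3 * (m + 1) + 4) * (81 * ((m + 1) * (m + 2)) * x ^ 3) := by ring
    _ ≤ (3 * (m + 1) + 4) * S0 := Nat.mul_le_mul_left _ hS0ge


/-- **THE ROW (SC) FAILS ON `C₄ + (1, k, k, k)` FOR EVERY `k ≥ 6`** (`n = 6k + 6`, tight layer `(3k + 4, 3k + 2)`). -/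
theorem not_shadowCumulative_kFam_all (k : ℕ) (hk : 6 ≤ k) :
    ¬ ShadowCumulative (ears (kFam k)) (3 * k + 4) (3 * k + 2) := by
  rcases Nat.lt_or_ge k 7 with h7 | h7
  · have : k = 6 := by omega
    subst this
    exact not_shadowCumulative_kFam6
  · intro h
    have hu := h (3 * k + 3) (by omega) (by omega)
    have h0 := card_shadowLev_ears (k := kFam k) (3 * k + 2)
    have h1 := card_shadowLev_ears (k := kFam k) (3 * k + 3)
    rw [sum_kFam] at h0 h1
    rw [show 3 * k + 1 + 3 = 3 * k + 4 by ring, show 3 * k + 1 + 1 = 3 * k + 2 by ring] at h0 h1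
    rw [h0, h1] at hu
    have harith := sc_level_succ_arith (n := 6 * k + 6) (q := 3 * k + 2) (by omega)
      (by rw [show 6 * k + 6 = 3 * k + 4 + (3 * k + 2) by ring]; exact hu)
    obtain ⟨m, rfl⟩ : ∃ m, k = m + 1 := ⟨k - 1, by omega⟩
    have hineq := family_ineq m (by omega)
    rw [show 6 * (m + 1) + 6 - (3 * (m + 1) + 2) = 3 * (m + 1) + 4 by omega,
      show 3 * (m + 1) + 2 + 1 = 3 * (m + 1) + 3 by ring] at harith
    omega

end PercRepro.RankDist
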